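import Summits.QuantumFields.YangMills.Theorems.SwapVirialDeficitPeriodicPrincipalLogLimitLevel
import Summits.QuantumFields.YangMills.Theorems.SwapVirialDeficitBlowUpPeriodicTwoScaleChartLevel
import HarnessLib

/-!
# The PERIODIC massive-mode rung, PJ6 with the hub coordinate INTEGRATED OUT: the principal log-limit from the a.e. two-parameter limit of the
# two-scale fibre volume (free-hands support of ⟨stmt-QuantumFields-24196⟩ `SwapVirialDeficit.ToronSoftnessSharp`; LEAD memo
# `sfw-p2-g96-memo-24196-PM-design.md` §2 «good-threshold route», ARCHITECTURE NOTE of 14:32Z: the socket PJ6 really needs)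

WHY.  The uniform-in-`a₀` sockets (I3′)/(I3′r) of ✓`relativeGap_fixedL_of_twoScaleLimit[_level]` ask for convergence of the fibre volume at EVERY hub value
`a₀`; by the exact scaling covariance `V_r(u,s,a₀) = a₀^{−N}·V_{r a₀⁴}(u/a₀,s,1)` this is atomlessness of the law of `Φ(0,0;1,·)` — a non-degeneracy statement
we do not have.  But PJ6 (✓`tendsto_div_log_of_twoScale`) only ever INTEGRATES its majorant/minorant `G` over the hub coordinate.  So:
* ★★ `lintegral_periodicKernel_hub` — `∫⁻ a, K_t(a,ρ) da = ρ⁻¹ · F_r(ρ, t/ρ²)`, `F_r(u,s) := ∫⁻ a, 4π·𝟙_{a²+u²<1}·twoScaleVolumeR L r u s a` (✓(I1′r));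
* ★★★ `periodicPrincipalLogLimit_of_hubIntegral` — if `F_r → I₀ ≠ ∞` along `𝓝[>]0 ×ˢ 𝓝[>]0` then
  `μ_L.real{F₀ ≤ s}/(s^{9L⁴−3/2}·log s⁻¹) → coneConst^{6L⁴+1}·I₀.toReal/(4·r^{9L⁴−3/2})` — PJ6 applied to the hub-AVERAGED kernel on the one-point space
  (same iterated integrals by Tonelli, so ✓`periodicKernel_deep`/`periodicKernel_outer` transfer and the (upper)/(lower) majorants are CONSTANTS);
* ★★★ `periodicPrincipalLogLimit_of_twoScale_ae` — the dischargeable socket (I3‴r): `M ≤ Mmax < ∞`, `a₀ ↦ twoScaleVolumeR L r u s a₀` measurable, and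
  `∀ᵐ a₀, a₀² < 1 → twoScaleVolumeR L r (·,·) a₀ → M a₀` along `𝓝[>]0 ×ˢ 𝓝[>]0` ⟹ the log-limit with `gI := (∫⁻ a₀ in Ioo (−1) 1, 4π·M a₀).toReal`
  (dominated convergence in `a₀` with ✓`twoScaleVolumeR_le`);
* ★★★ `relativeGap_fixedL_of_twoScaleLimit_ae`, ★★ `periodicMeanAction_fixedL_of_twoScale_ae` — the consumers (✓`relativeGap_fixedL_of_periodicLogLimit`,
  ✓`tendsto_periodicMeanAction_of_principalLogLimit`).
HONEST LABEL: measure-theoretic plumbing (plan-level fixed-`L` rung of a DRAFT line); (I3‴r) itself is brick (B) (not here); PM NOT proved; ⟨24196⟩ ⟨24194⟩ ⟨24197⟩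
⟨24497⟩ OPEN; own crux ⟨22884⟩ OPEN (blocked-on ⟨19935⟩); the Yang–Mills mass gap is NOT proved; no summit is proved by a line.
LEAD seat ym-line-sfw-p2 g96 (cell ym-idea-1, free hands), `--supports stmt-QuantumFields-24196`.  THEOREMS ONLY, standard axioms, 0 `sorry`.
References: [cite: Luscher1983, §2]; [cite: GonzalezarroyoAltes1988]; [folklore].
-/

set_option autoImplicit false

noncomputable section

open MeasureTheory Quaternion Set Filter Topology
open scoped Quaternion ENNReal BigOperators
open Literature.MathematicalPhysics.QuantumLattice
open Literature.MathematicalPhysics.QuantumFieldTheory hiding SU2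
open Summit.QuantumFields.YangMills.Theorems.SwapTwistDeficit.ToronLog

namespace Summit.QuantumFields.YangMills.Theorems.SwapVirialDeficit.BlowUpRing

open Summit.QuantumFields.YangMills.Theorems.FemtoTransferGap
open Summit.QuantumFields.YangMills.Theorems.FemtoTransferGap.TT
open Summit.QuantumFields.YangMills.Theorems.VirialFluxGap.RingDeficit
open Summit.QuantumFields.YangMills.Theorems.SwapVirialDeficit.BlowUp (tendsto_div_log_of_twoScale)
open Summit.QuantumFields.YangMills.Theorems.SwapVirialDeficit.PeriodicRing (tendsto_periodicMeanAction_of_principalLogLimit)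

variable {L : ℕ} [NeZero L]

/-! ## §1 Integrating the kernel over the hub coordinate -/

/-- Tonelli for the kernel with the radial variable restricted: `∫⁻ ρ ∈ S, ∫⁻ a, K(a,ρ) = ∫⁻ a, ∫⁻ ρ ∈ S, K(a,ρ)`. [folklore] -/
theorem lintegral_restrict_lintegral_swap {K : ℝ × ℝ → ℝ≥0∞} (hK : Measurable K) (S : Set ℝ) :
    ∫⁻ ρ in S, ∫⁻ a, K (a, ρ) ∂(volume : Measure ℝ) ∂(volume : Measure ℝ) =
      ∫⁻ a, ∫⁻ ρ in S, K (a, ρ) ∂(volume : Measure ℝ) ∂(volume : Measure ℝ) := by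
  have h : Measurable (fun p : ℝ × ℝ => K (p.2, p.1)) := hK.comp measurable_swap
  exact lintegral_lintegral_swap (μ := (volume : Measure ℝ).restrict S) (ν := (volume : Measure ℝ))
    (f := fun ρ a => K (a, ρ)) h.aemeasurable

/-- ★★ **The hub integral of the kernel through the two-scale chart**: for `ρ > 0`,
`∫⁻ a, periodicKernel L 0 1 t (r·t²) (a, ρ) da = ρ⁻¹ · ∫⁻ a, 4π·𝟙_{a²+ρ²<1}·twoScaleVolumeR L r ρ (t/ρ²) a`. [cite: Luscher1983, §2] -/
theorem lintegral_periodicKernel_hub (r t : ℝ) {ρ : ℝ} (hρ : 0 < ρ) :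
    ∫⁻ a, periodicKernel L (fun _ => false) (fun _ => 1) t (r * t ^ 2) (a, ρ) ∂(volume : Measure ℝ) =
      ENNReal.ofReal ρ⁻¹ * ∫⁻ a, ENNReal.ofReal (4 * Real.pi) * {a : ℝ | a ^ 2 + ρ ^ 2 < 1}.indicator 1 a * twoScaleVolumeR L r ρ (t / ρ ^ 2) a
        ∂(volume : Measure ℝ) := by
  rw [← lintegral_const_mul' _ _ ENNReal.ofReal_ne_top]
  refine lintegral_congr fun a => ?_
  rw [periodicKernel_eq_indicator_twoScaleVolumeR r t hρ a]
  have hind : ({p : ℝ × ℝ | p.1 ^ 2 + p.2 ^ 2 < 1} : Set (ℝ × ℝ)).indicator (1 : ℝ × ℝ → ℝ≥0∞) (a, ρ) =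
      ({a : ℝ | a ^ 2 + ρ ^ 2 < 1} : Set ℝ).indicator 1 a := by
    simp only [Set.indicator_apply, Set.mem_setOf_eq, Pi.one_apply]
  rw [hind]; ring

/-- From an eventuality along `𝓝[>]0 ×ˢ 𝓝[>]0` to a square `(0,θ) × (0,θ)`. [folklore] -/
theorem exists_square_of_eventually {p : ℝ × ℝ → Prop} (h : ∀ᶠ q in 𝓝[>] (0 : ℝ) ×ˢ 𝓝[>] (0 : ℝ), p q) :
    ∃ θ : ℝ, 0 < θ ∧ ∀ u ∈ Ioo (0 : ℝ) θ, ∀ s ∈ Ioo (0 : ℝ) θ, p (u, s) := by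
  obtain ⟨U, hU, V, hV, hUV⟩ := Filter.eventually_prod_iff.1 h
  obtain ⟨θ₁, hθ₁, h1⟩ := mem_nhdsGT_iff_exists_Ioo_subset.1 hU
  obtain ⟨θ₂, hθ₂, h2⟩ := mem_nhdsGT_iff_exists_Ioo_subset.1 hV
  refine ⟨min θ₁ θ₂, lt_min hθ₁ hθ₂, fun u hu s hs => hUV (h1 ⟨hu.1, hu.2.trans_le (min_le_left _ _)⟩) (h2 ⟨hs.1, hs.2.trans_le (min_le_right _ _)⟩)⟩

/-- The two scales `(ρ, t/ρ²)` lie in the square `(0,θ)²` once `√t/√θ < ρ ≤ θ/2`. [folklore] -/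
theorem twoScale_mem_square {θ t ρ : ℝ} (hθ : 0 < θ) (ht : 0 < t) (hρ : ρ ∈ Ioc ((Real.sqrt θ)⁻¹ * Real.sqrt t) (θ / 2)) :
    ρ ∈ Ioo (0 : ℝ) θ ∧ t / ρ ^ 2 ∈ Ioo (0 : ℝ) θ := by
  have hsθ : 0 < Real.sqrt θ := Real.sqrt_pos.2 hθ
  have hst : 0 < Real.sqrt t := Real.sqrt_pos.2 ht
  have hA : 0 < (Real.sqrt θ)⁻¹ * Real.sqrt t := by positivity
  have hρ0 : 0 < ρ := hA.trans hρ.1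
  refine ⟨⟨hρ0, hρ.2.trans_lt (by linarith)⟩, div_pos ht (by positivity), ?_⟩
  rw [div_lt_iff₀ (by positivity)]
  -- `t = (√t)² < (ρ √θ)² = ρ² θ`
  have h1 : Real.sqrt t < ρ * Real.sqrt θ := by
    have := mul_lt_mul_of_pos_left hρ.1 hsθ
    rwa [← mul_assoc, mul_inv_cancel₀ hsθ.ne', one_mul, mul_comm] at this
  have h2 : Real.sqrt t ^ 2 < (ρ * Real.sqrt θ) ^ 2 := by gcongr
  rw [Real.sq_sqrt ht.le, mul_pow, Real.sq_sqrt hθ.le] at h2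
  linarith

/-! ## §2 PJ6 with the hub integrated out -/

/-- ★★★ **THE PRINCIPAL ZERO-FLUX LOG-LIMIT FROM THE HUB-INTEGRATED TWO-SCALE VOLUME**: if
`F_r(u,s) := ∫⁻ a, 4π·𝟙_{a²+u²<1}·twoScaleVolumeR L r u s a → I₀ ≠ ∞` as `(u,s) → (0⁺,0⁺)`, then
`μ_L.real{F₀ ≤ s}/(s^{9L⁴−3/2}·log s⁻¹) → coneConst^{6L⁴+1}·I₀.toReal/(4·r^{9L⁴−3/2})`. [cite: Luscher1983, §2] [cite: GonzalezarroyoAltes1988] -/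
theorem periodicPrincipalLogLimit_of_hubIntegral (L : ℕ) [NeZero L] {r : ℝ} (hr : 0 < r) {I₀ : ℝ≥0∞} (hI₀ : I₀ ≠ ∞)
    (hF : Tendsto (fun p : ℝ × ℝ => ∫⁻ a, ENNReal.ofReal (4 * Real.pi) * {a : ℝ | a ^ 2 + p.1 ^ 2 < 1}.indicator 1 a * twoScaleVolumeR L r p.1 p.2 a
      ∂(volume : Measure ℝ)) (𝓝[>] (0 : ℝ) ×ˢ 𝓝[>] (0 : ℝ)) (𝓝 I₀)) :
    Tendsto (fun s : ℝ => (ringMeasure L).real {P | ringDeficit L (fun _ => false) P ≤ s} / (s ^ (9 * (L : ℝ) ^ 4 - 3 / 2) * Real.log s⁻¹))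
      (𝓝[>] 0) (𝓝 (coneConst ^ (6 * L ^ 4 + 1) * I₀.toReal / (4 * r ^ (9 * (L : ℝ) ^ 4 - 3 / 2)))) := by
  set α : ℝ := 9 * (L : ℝ) ^ 4 - 3 / 2 with hαdef
  set gI : ℝ := I₀.toReal with hgIdef
  have hgI : 0 ≤ gI := ENNReal.toReal_nonneg
  have hI₀eq : I₀ = ENNReal.ofReal gI := (ENNReal.ofReal_toReal hI₀).symm
  set K : ℝ → ℝ × ℝ → ℝ≥0∞ := fun t => periodicKernel L (fun _ => false) (fun _ => 1) t (r * t ^ 2) with hK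
  have hKm : ∀ t, Measurable (K t) := fun t => measurable_periodicKernel _ _ t _
  set F : ℝ × ℝ → ℝ≥0∞ := fun p => ∫⁻ a, ENNReal.ofReal (4 * Real.pi) * {a : ℝ | a ^ 2 + p.1 ^ 2 < 1}.indicator 1 a *
    twoScaleVolumeR L r p.1 p.2 a ∂(volume : Measure ℝ) with hFdef
  -- the hub-averaged kernel on the one-point space
  set Kb : ℝ → Unit × ℝ → ℝ≥0∞ := fun t q => ∫⁻ a, K t (a, q.2) ∂(volume : Measure ℝ) with hKb
  have hKbm : ∀ t, Measurable (Kb t) := fun t => ((hKm t).lintegral_prod_left').comp measurable_snd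
  set σ : Measure Unit := Measure.dirac () with hσ
  have hswap : ∀ t (S : Set ℝ), ∫⁻ x, (∫⁻ ρ in S, Kb t (x, ρ)) ∂σ = ∫⁻ a, (∫⁻ ρ in S, K t (a, ρ)) ∂(volume : Measure ℝ) := by
    intro t S
    rw [hσ, lintegral_dirac]
    exact lintegral_restrict_lintegral_swap (hKm t) S
  have hKbρ : ∀ t ρ, 0 < ρ → ∀ x, Kb t (x, ρ) = ENNReal.ofReal ρ⁻¹ * F (ρ, t / ρ ^ 2) := by
    intro t ρ hρ x
    simp only [hKb, hK, hFdef]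
    exact lintegral_periodicKernel_hub r t hρ
  have hdeep : ∀ A : ℝ, 0 < A → ∃ C : ℝ≥0∞, C ≠ ∞ ∧ ∀ᶠ t in 𝓝[>] (0 : ℝ),
      ∫⁻ x, (∫⁻ ρ in Ioc 0 (A * Real.sqrt t), Kb t (x, ρ)) ∂σ ≤ C := by
    intro A hA
    obtain ⟨C, hC, h⟩ := periodicKernel_deep (L := L) hr.le A hA
    exact ⟨C, hC, h.mono fun t ht => by rw [hswap]; exact ht⟩
  have houter : ∀ δ : ℝ, 0 < δ → ∃ C : ℝ≥0∞, C ≠ ∞ ∧ ∀ᶠ t in 𝓝[>] (0 : ℝ),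
      ∫⁻ x, (∫⁻ ρ in Ioi δ, Kb t (x, ρ)) ∂σ ≤ C := by
    intro δ hδ
    obtain ⟨C, hC, h⟩ := periodicKernel_outer (L := L) hr.le δ hδ
    exact ⟨C, hC, h.mono fun t ht => by rw [hswap]; exact ht⟩
  have hupper : ∀ ε : ℝ, 0 < ε → ∃ A δ : ℝ, 0 < A ∧ 0 < δ ∧ ∃ G : Unit → ℝ≥0∞, ∫⁻ x, G x ∂σ ≤ ENNReal.ofReal (gI + ε) ∧
      ∀ᶠ t in 𝓝[>] (0 : ℝ), ∀ x, ∀ ρ ∈ Ioc (A * Real.sqrt t) δ, Kb t (x, ρ) ≤ G x * ENNReal.ofReal ρ⁻¹ := by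
    intro ε hε
    have hlt : I₀ < ENNReal.ofReal (gI + ε) := by
      rw [hI₀eq]; exact (ENNReal.ofReal_lt_ofReal_iff (by linarith)).2 (by linarith)
    obtain ⟨θ, hθ, hsq⟩ := exists_square_of_eventually (hF.eventually (Iio_mem_nhds hlt))
    refine ⟨(Real.sqrt θ)⁻¹, θ / 2, by positivity, by positivity, fun _ => ENNReal.ofReal (gI + ε), ?_, ?_⟩
    · rw [hσ, lintegral_dirac]
    · filter_upwards [self_mem_nhdsWithin] with t ht x ρ hρ
      obtain ⟨hu, hs⟩ := twoScale_mem_square hθ ht hρ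
      rw [hKbρ t ρ hu.1 x, mul_comm]
      exact mul_le_mul' (hsq ρ hu _ hs).le le_rfl
  have hlower : ∀ ε : ℝ, 0 < ε → ∃ A δ : ℝ, 0 < A ∧ 0 < δ ∧ ∃ G : Unit → ℝ≥0∞, ENNReal.ofReal (gI - ε) ≤ ∫⁻ x, G x ∂σ ∧
      ∀ᶠ t in 𝓝[>] (0 : ℝ), ∀ x, ∀ ρ ∈ Ioc (A * Real.sqrt t) δ, G x * ENNReal.ofReal ρ⁻¹ ≤ Kb t (x, ρ) := by
    intro ε hε
    by_cases hneg : gI - ε < 0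
    · refine ⟨1, 1, one_pos, one_pos, fun _ => 0, by rw [ENNReal.ofReal_of_nonpos hneg.le]; exact bot_le, ?_⟩
      exact Filter.Eventually.of_forall fun t x ρ _ => by rw [zero_mul]; exact bot_le
    · have hlt : ENNReal.ofReal (gI - ε) < I₀ := by
        rw [hI₀eq]; exact (ENNReal.ofReal_lt_ofReal_iff_of_nonneg (by linarith)).2 (by linarith)
      obtain ⟨θ, hθ, hsq⟩ := exists_square_of_eventually (hF.eventually (Ioi_mem_nhds hlt))
      refine ⟨(Real.sqrt θ)⁻¹, θ / 2, by positivity, by positivity, fun _ => ENNReal.ofReal (gI - ε), ?_, ?_⟩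
      · rw [hσ, lintegral_dirac]
      · filter_upwards [self_mem_nhdsWithin] with t ht x ρ hρ
        obtain ⟨hu, hs⟩ := twoScale_mem_square hθ ht hρ
        rw [hKbρ t ρ hu.1 x, mul_comm]
        exact mul_le_mul' le_rfl (hsq ρ hu _ hs).le
  have hT0 := tendsto_div_log_of_twoScale σ hKbm hgI hdeep houter hupper hlower
  have hT : Tendsto (fun t : ℝ => (∫⁻ a, (∫⁻ ρ in Ioi 0, K t (a, ρ)) ∂(volume : Measure ℝ)).toReal / Real.log (1 / t))
      (𝓝[>] (0 : ℝ)) (𝓝 (gI / 2)) := by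
    refine hT0.congr' (Filter.Eventually.of_forall fun t => ?_)
    rw [hswap]
  -- reparametrise: `s = r·u`, `t = √u` (verbatim the tail of ✓`periodicPrincipalLogLimit_of_twoScale_level`)
  have hT2 := hT.comp (tendsto_sqrt_nhdsGT_zero.comp (tendsto_div_const_nhdsGT_zero hr))
  have hL := log_ratio_tendsto hr
  have hprod : Tendsto (fun s : ℝ => coneConst ^ (6 * L ^ 4 + 1) / (2 * r ^ α) *
      (((∫⁻ x, (∫⁻ ρ in Ioi 0, K (Real.sqrt (s / r)) (x, ρ)) ∂(volume : Measure ℝ)).toReal / Real.log (1 / Real.sqrt (s / r))) *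
        (Real.log (s / r)⁻¹ / Real.log s⁻¹))) (𝓝[>] (0 : ℝ))
      (𝓝 (coneConst ^ (6 * L ^ 4 + 1) / (2 * r ^ α) * ((gI / 2) * 1))) := (hT2.mul hL).const_mul _
  have htarget : coneConst ^ (6 * L ^ 4 + 1) * gI / (4 * r ^ α) = coneConst ^ (6 * L ^ 4 + 1) / (2 * r ^ α) * ((gI / 2) * 1) := by ring
  rw [htarget]
  refine hprod.congr' ?_
  filter_upwards [self_mem_nhdsWithin, Ioo_mem_nhdsGT (show (0 : ℝ) < min 1 r by positivity)] with s hs hs1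
  have hs0 : 0 < s := hs
  have hsr : s < r := hs1.2.trans_le (min_le_right _ _)
  have hs1' : s < 1 := hs1.2.trans_le (min_le_left _ _)
  have hu0 : 0 < s / r := div_pos hs0 hr
  have hsq : 0 < Real.sqrt (s / r) := Real.sqrt_pos.2 hu0
  have hvol := ringMeasure_ringDeficit_le_eq_kernel_sqrt (L := L) (fun _ => false) (χ := fun _ => 1) (fun _ k => by rw [one_mul, mul_one]) r hu0
  have hrs : r * (s / r) = s := by field_simp
  rw [hrs] at hvol
  have hlog : Real.log (1 / Real.sqrt (s / r)) = Real.log (s / r)⁻¹ / 2 := by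
    rw [one_div, Real.log_inv, Real.log_inv, Real.log_sqrt hu0.le]; ring
  have hlogu : 0 < Real.log (s / r)⁻¹ := Real.log_pos (one_lt_inv₀ hu0 |>.2 (by rw [div_lt_one hr]; exact hsr))
  have hlogs : 0 < Real.log s⁻¹ := Real.log_pos (one_lt_inv₀ hs0 |>.2 hs1')
  have hαu : 0 < (s / r) ^ α := Real.rpow_pos_of_pos hu0 _
  have hαs : 0 < s ^ α := Real.rpow_pos_of_pos hs0 _
  have hαr : 0 < r ^ α := Real.rpow_pos_of_pos hr _
  have hsplit : (s / r) ^ α = s ^ α / r ^ α := Real.div_rpow hs0.le hr.le α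
  rw [← hαdef, hsplit] at hvol
  have h1 : Real.log (r / s) ≠ 0 := by rw [← inv_div]; exact hlogu.ne'
  have h2 : Real.log (1 / s) ≠ 0 := by rw [one_div]; exact hlogs.ne'
  have h3 : Real.log (s / r)⁻¹ ≠ 0 := hlogu.ne'
  have h4 : Real.log s⁻¹ ≠ 0 := hlogs.ne'
  have hc0 : 0 ≤ coneConst := by rw [coneConst]; exact ENNReal.toReal_nonneg
  rw [measureReal_def, hvol, ENNReal.toReal_mul, ENNReal.toReal_ofReal (by positivity), hlog]
  simp only [hK, Real.sq_sqrt hu0.le, hrs]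
  field_simp

/-! ## §3 The dischargeable socket (I3‴r): a.e. two-parameter convergence of the fibre volume -/

/-- ★★★ **PJ6 FROM THE a.e. TWO-PARAMETER LIMIT OF THE TWO-SCALE VOLUME** (socket (I3‴r)): `M` bounded (measurability of `M` is not even needed),
`a₀ ↦ twoScaleVolumeR L r u s a₀` measurable, and `twoScaleVolumeR L r u s a₀ → M a₀` as `(u,s) → (0⁺,0⁺)` for a.e. `a₀` with `a₀² < 1` ⟹
`μ_L.real{F₀ ≤ s}/(s^{9L⁴−3/2}·log s⁻¹) → coneConst^{6L⁴+1}·gI/(4·r^{9L⁴−3/2})`, `gI := (∫⁻ a₀ in Ioo (−1) 1, 4π·M a₀).toReal`. [cite: Luscher1983, §2] -/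
theorem periodicPrincipalLogLimit_of_twoScale_ae (L : ℕ) [NeZero L] {r : ℝ} (hr : 0 < r) {M : ℝ → ℝ≥0∞} {Mmax : ℝ≥0∞} (hMmax : Mmax ≠ ∞)
    (hMb : ∀ a₀, M a₀ ≤ Mmax) (hVm : ∀ u s : ℝ, Measurable fun a₀ : ℝ => twoScaleVolumeR L r u s a₀)
    (hlim : ∀ᵐ a₀ ∂(volume : Measure ℝ), a₀ ^ 2 < 1 →
      Tendsto (fun p : ℝ × ℝ => twoScaleVolumeR L r p.1 p.2 a₀) (𝓝[>] (0 : ℝ) ×ˢ 𝓝[>] (0 : ℝ)) (𝓝 (M a₀))) :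
    Tendsto (fun s : ℝ => (ringMeasure L).real {P | ringDeficit L (fun _ => false) P ≤ s} / (s ^ (9 * (L : ℝ) ^ 4 - 3 / 2) * Real.log s⁻¹))
      (𝓝[>] 0) (𝓝 (coneConst ^ (6 * L ^ 4 + 1) * (∫⁻ a₀ in Ioo (-1 : ℝ) 1, ENNReal.ofReal (4 * Real.pi) * M a₀ ∂(volume : Measure ℝ)).toReal /
        (4 * r ^ (9 * (L : ℝ) ^ 4 - 3 / 2)))) := by
  obtain ⟨Vmax, hVmax, hV⟩ := twoScaleVolumeR_le (L := L) hr.le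
  set c : ℝ≥0∞ := ENNReal.ofReal (4 * Real.pi) with hc
  have hIoo : ∀ a : ℝ, a ∈ Ioo (-1 : ℝ) 1 ↔ a ^ 2 < 1 := fun a => by
    rw [Set.mem_Ioo, sq_lt_one_iff_abs_lt_one, abs_lt]
  -- the limit integral is finite
  set I₀ : ℝ≥0∞ := ∫⁻ a₀ in Ioo (-1 : ℝ) 1, c * M a₀ ∂(volume : Measure ℝ) with hI₀def
  have hI₀ : I₀ ≠ ∞ := by
    refine ne_top_of_le_ne_top (b := ∫⁻ _ in Ioo (-1 : ℝ) 1, c * Mmax ∂(volume : Measure ℝ)) ?_ (setLIntegral_mono' measurableSet_Ioo fun a _ => ?_)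
    · rw [setLIntegral_const, Real.volume_Ioo]
      exact ENNReal.mul_ne_top (ENNReal.mul_ne_top ENNReal.ofReal_ne_top hMmax) ENNReal.ofReal_ne_top
    · exact mul_le_mul' le_rfl (hMb a)
  -- dominated convergence in the hub coordinate
  have hF : Tendsto (fun p : ℝ × ℝ => ∫⁻ a, c * {a : ℝ | a ^ 2 + p.1 ^ 2 < 1}.indicator 1 a * twoScaleVolumeR L r p.1 p.2 a
      ∂(volume : Measure ℝ)) (𝓝[>] (0 : ℝ) ×ˢ 𝓝[>] (0 : ℝ)) (𝓝 I₀) := by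
    have hI₀' : I₀ = ∫⁻ a, c * (Ioo (-1 : ℝ) 1).indicator 1 a * M a ∂(volume : Measure ℝ) := by
      rw [hI₀def, ← lintegral_indicator measurableSet_Ioo]
      refine lintegral_congr fun a => ?_
      by_cases ha : a ∈ Ioo (-1 : ℝ) 1
      · rw [Set.indicator_of_mem ha, Set.indicator_of_mem ha, Pi.one_apply, mul_one]
      · rw [Set.indicator_of_notMem ha, Set.indicator_of_notMem ha, mul_zero, zero_mul]
    rw [hI₀']
    have hpos : ∀ᶠ p : ℝ × ℝ in 𝓝[>] (0 : ℝ) ×ˢ 𝓝[>] (0 : ℝ), 0 < p.1 ∧ 0 < p.2 :=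
      Filter.prod_mem_prod self_mem_nhdsWithin self_mem_nhdsWithin
    refine tendsto_lintegral_filter_of_dominated_convergence (fun a => c * (Ioo (-1 : ℝ) 1).indicator (fun _ => Vmax) a) ?_ ?_ ?_ ?_
    · refine Filter.Eventually.of_forall fun p => ?_
      have hS : MeasurableSet {a : ℝ | a ^ 2 + p.1 ^ 2 < 1} := measurableSet_lt (by fun_prop) measurable_const
      exact (measurable_const.mul (measurable_one.indicator hS)).mul (hVm p.1 p.2)
    · refine hpos.mono fun p hp => Filter.Eventually.of_forall fun a => ?_
      by_cases ha : a ^ 2 + p.1 ^ 2 < 1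
      · have ha' : a ∈ Ioo (-1 : ℝ) 1 := (hIoo a).2 (by nlinarith)
        rw [Set.indicator_of_mem (show a ∈ {a : ℝ | a ^ 2 + p.1 ^ 2 < 1} from ha), Set.indicator_of_mem ha', Pi.one_apply, mul_one]
        exact mul_le_mul' le_rfl (hV p.1 p.2 a hp.1 hp.2 ha)
      · rw [Set.indicator_of_notMem (show a ∉ {a : ℝ | a ^ 2 + p.1 ^ 2 < 1} from ha), mul_zero, zero_mul]
        exact bot_le
    · rw [← lintegral_indicator measurableSet_Ioo] at *
      have h : ∫⁻ a, c * (Ioo (-1 : ℝ) 1).indicator (fun _ => Vmax) a ∂(volume : Measure ℝ) =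
          ∫⁻ a, (Ioo (-1 : ℝ) 1).indicator (fun _ => c * Vmax) a ∂(volume : Measure ℝ) := by
        refine lintegral_congr fun a => ?_
        by_cases ha : a ∈ Ioo (-1 : ℝ) 1
        · rw [Set.indicator_of_mem ha, Set.indicator_of_mem ha]
        · rw [Set.indicator_of_notMem ha, Set.indicator_of_notMem ha, mul_zero]
      rw [h, lintegral_indicator measurableSet_Ioo, setLIntegral_const, Real.volume_Ioo]
      exact ENNReal.mul_ne_top (ENNReal.mul_ne_top ENNReal.ofReal_ne_top hVmax) ENNReal.ofReal_ne_top
    · filter_upwards [hlim] with a ha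
      by_cases hain : a ∈ Ioo (-1 : ℝ) 1
      · have ha2 : a ^ 2 < 1 := (hIoo a).1 hain
        rw [Set.indicator_of_mem hain, Pi.one_apply, mul_one]
        -- eventually the moving half-disc contains `a`
        have hev : ∀ᶠ p : ℝ × ℝ in 𝓝[>] (0 : ℝ) ×ˢ 𝓝[>] (0 : ℝ), a ^ 2 + p.1 ^ 2 < 1 := by
          have h1 : ∀ᶠ u in 𝓝[>] (0 : ℝ), u ∈ Ioo (0 : ℝ) (Real.sqrt (1 - a ^ 2)) :=
            Ioo_mem_nhdsGT (Real.sqrt_pos.2 (by linarith))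
          have h2 : ∀ᶠ p : ℝ × ℝ in 𝓝[>] (0 : ℝ) ×ˢ 𝓝[>] (0 : ℝ), p.1 ∈ Ioo (0 : ℝ) (Real.sqrt (1 - a ^ 2)) :=
            Filter.tendsto_fst.eventually h1
          refine h2.mono fun p hp => ?_
          have hlt : p.1 ^ 2 < Real.sqrt (1 - a ^ 2) ^ 2 := by gcongr <;> linarith [hp.1, hp.2]
          rw [Real.sq_sqrt (by linarith)] at hlt
          linarith
        have hcm := ENNReal.Tendsto.const_mul (ha ha2) (Or.inr ENNReal.ofReal_ne_top) (a := c)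
        refine hcm.congr' (hev.mono fun p hp => ?_)
        show c * twoScaleVolumeR L r p.1 p.2 a = c * {a' : ℝ | a' ^ 2 + p.1 ^ 2 < 1}.indicator 1 a * twoScaleVolumeR L r p.1 p.2 a
        rw [Set.indicator_of_mem (show a ∈ {a' : ℝ | a' ^ 2 + p.1 ^ 2 < 1} from hp), Pi.one_apply, mul_one]
      · have ha2 : ¬ a ^ 2 < 1 := fun h => hain ((hIoo a).2 h)
        rw [Set.indicator_of_notMem hain, mul_zero, zero_mul]
        refine tendsto_const_nhds.congr' (Filter.Eventually.of_forall fun p => ?_)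
        have hp : a ∉ {a' : ℝ | a' ^ 2 + p.1 ^ 2 < 1} := fun h => ha2 (by simp only [Set.mem_setOf_eq] at h; nlinarith)
        show (0 : ℝ≥0∞) = c * {a' : ℝ | a' ^ 2 + p.1 ^ 2 < 1}.indicator 1 a * twoScaleVolumeR L r p.1 p.2 a
        rw [Set.indicator_of_notMem hp, mul_zero, zero_mul]
  exact periodicPrincipalLogLimit_of_hubIntegral L hr hI₀ hF

/-! ## §4 The consumers: fixed-`L` relative gap and mean action from (I3‴r) -/

/-- ★★★ **THE FIXED-`L` RELATIVE GAP FROM THE a.e. TWO-SCALE LIMIT** (socket (I3‴r); ✓`relativeGap_fixedL_of_periodicLogLimit` ∘ ✓`periodicPrincipalLogLimit_of_twoScale_ae`).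
[cite: Griffiths1964] [cite: tHooft1979] [cite: Luscher1983, §2] -/
theorem relativeGap_fixedL_of_twoScaleLimit_ae {ε : ℝ} (hε : 0 < ε) :
    ∃ L₀ : ℕ, ∀ (L : ℕ) [NeZero L], L₀ ≤ L → ∀ {r : ℝ}, 0 < r →
      ∀ (M : ℝ → ℝ≥0∞) (Mmax : ℝ≥0∞), Mmax ≠ ∞ → (∀ a₀, M a₀ ≤ Mmax) →
      (∀ u s : ℝ, Measurable fun a₀ : ℝ => twoScaleVolumeR L r u s a₀) →
      (∀ᵐ a₀ ∂(volume : Measure ℝ), a₀ ^ 2 < 1 →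
        Tendsto (fun p : ℝ × ℝ => twoScaleVolumeR L r p.1 p.2 a₀) (𝓝[>] (0 : ℝ) ×ˢ 𝓝[>] (0 : ℝ)) (𝓝 (M a₀))) →
      0 < (∫⁻ a₀ in Ioo (-1 : ℝ) 1, ENNReal.ofReal (4 * Real.pi) * M a₀ ∂(volume : Measure ℝ)).toReal →
      ∃ β₀ : ℝ, ∀ β : ℝ, β₀ ≤ β →
        β * deriv (fun b : ℝ => Real.log (TT.twistTrace L b (2 * L))) β -
            β * deriv (fun b : ℝ => Real.log (TT.physTrace L b (2 * L))) β ≤ -(1 / 2 - 2 * ε) := by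
  obtain ⟨L₀, h⟩ := relativeGap_fixedL_of_periodicLogLimit hε
  refine ⟨L₀, fun L _ hL r hr M Mmax hMmax hMb hVm hlim hgI => ?_⟩
  have hv : 0 < coneConst ^ (6 * L ^ 4 + 1) * (∫⁻ a₀ in Ioo (-1 : ℝ) 1, ENNReal.ofReal (4 * Real.pi) * M a₀ ∂(volume : Measure ℝ)).toReal /
      (4 * r ^ (9 * (L : ℝ) ^ 4 - 3 / 2)) := by
    have h1 : 0 < r ^ (9 * (L : ℝ) ^ 4 - 3 / 2) := Real.rpow_pos_of_pos hr _
    have h2 : 0 < coneConst := coneConst_pos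
    positivity
  exact h L hL hv (periodicPrincipalLogLimit_of_twoScale_ae L hr hMmax hMb hVm hlim)

/-- ★★ **THE FIXED-`L` PERIODIC MEAN ACTION FROM THE a.e. TWO-SCALE LIMIT** (socket (I3‴r), `gI > 0`). [cite: Griffiths1964] [cite: Luscher1983, §2] -/
theorem periodicMeanAction_fixedL_of_twoScale_ae (L : ℕ) [NeZero L] {r : ℝ} (hr : 0 < r) {M : ℝ → ℝ≥0∞} {Mmax : ℝ≥0∞} (hMmax : Mmax ≠ ∞)
    (hMb : ∀ a₀, M a₀ ≤ Mmax) (hVm : ∀ u s : ℝ, Measurable fun a₀ : ℝ => twoScaleVolumeR L r u s a₀)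
    (hlim : ∀ᵐ a₀ ∂(volume : Measure ℝ), a₀ ^ 2 < 1 →
      Tendsto (fun p : ℝ × ℝ => twoScaleVolumeR L r p.1 p.2 a₀) (𝓝[>] (0 : ℝ) ×ˢ 𝓝[>] (0 : ℝ)) (𝓝 (M a₀)))
    (hgI : 0 < (∫⁻ a₀ in Ioo (-1 : ℝ) 1, ENNReal.ofReal (4 * Real.pi) * M a₀ ∂(volume : Measure ℝ)).toReal) :
    Tendsto (fun b : ℝ => b * deriv (fun x : ℝ => Real.log (TT.sectorWeight (L := L) x (2 * L - 1) (fun _ => false) (fun _ _ => (1 : ℝ)))) b -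
        12 * b * (L : ℝ) ^ 4) atTop (𝓝 (-(9 * (L : ℝ) ^ 4 - 3 / 2))) := by
  have hv : 0 < coneConst ^ (6 * L ^ 4 + 1) * (∫⁻ a₀ in Ioo (-1 : ℝ) 1, ENNReal.ofReal (4 * Real.pi) * M a₀ ∂(volume : Measure ℝ)).toReal /
      (4 * r ^ (9 * (L : ℝ) ^ 4 - 3 / 2)) := by
    have h1 : 0 < r ^ (9 * (L : ℝ) ^ 4 - 3 / 2) := Real.rpow_pos_of_pos hr _
    have h2 : 0 < coneConst := coneConst_pos
    positivity
  exact tendsto_periodicMeanAction_of_principalLogLimit L hv (periodicPrincipalLogLimit_of_twoScale_ae L hr hMmax hMb hVm hlim)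

end Summit.QuantumFields.YangMills.Theorems.SwapVirialDeficit.BlowUpRing

end
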